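import Literature.NumberTheory.Transcendental.PadicCW77Assembly
import Summits.ABC.StewartYu.PadicCW77Sizes
import Summits.ABC.StewartYu.PadicCW77Junctions
import Summits.ABC.StewartYu.PadicW80NumericB
import Summits.ABC.StewartYu.PadicW80ParEnvelope
import Summits.ABC.ABC.Theses.PadicPrincipalCoreST86
import Mathlib.NumberTheory.Height.NumberField
import Mathlib.Analysis.Complex.ExponentialBounds
import HarnessLib

/-!
# Route PadicPrincipalCoreST86, crux item `TheoremA` (stmt-ABC-18951): the parameter pack with ALL
# inputs discharged, Theorem A, and the item

`Summits/ABC/ABC/Theorems/PadicPrincipalCoreST86TheoremA.lean` — cell `abc-stewartyu` (HOME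
`run/shared/lean/pub/abc-stewartyu/`, seat p3; one structure-valued `def` + theorems, no named fact).
Three parts (formerly staged as `StewartYu/PadicCW77Pack.lean`, `StewartYu/PadicCW77TheoremA.lean`
and this item file; merged to save two gate layers):

**Part 1 — the pack** (on p2's `PadicCW77Assembly.lean`: `ParamPack`, `norm_Λ₀_gt_of_paramPack`,
`kFinal_of_log_ineq`; p1's record and numerics `PadicW80Par{,B–F}`, `PadicW80Numeric{,B}`:
`kstep_ineq_one/two`, `halfstep_ineq_one/two`, `log_p_le_U`, `one_le_tJ`, `tJ_mul_le`, `even_S₀`,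
`room_half`; p2's height link `SizeHyp`; p3's `PadicW80Budgets.lean` / `PadicCW77Sizes.lean` (J1/J2: closed forms, budgets, `KSizes`,
`Siegel`, `Endgame`) and `PadicCW77Junctions.lean` (J3, `hFinalHalf_of_log_ineq`, `hSizesHalf_of_hyp`)): `sizeHyp_of_logHeight`, `PintP`,
**`paramPackOf`** (`S.ParamPack P.Up`, EVERY field discharged), **`norm_Λ₀_gt`**,
`norm_Λ₀_gt_of_logHeight`.

**Part 2 — Theorem A** (p2's closing adapter `PadicCW77.theoremAShapeLe_of_packs` + envelope
`PadicW80Par.U_le_Cw'`): `packs_exist`, **`theoremAShapeLe_one_holds : TheoremAShapeLe 1`**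
(`c₁ = 2⁷⁰`, `c₂ = 1`, `r = 0`), **`theoremAShape_holds : TheoremAShape`**.

**Part 3 — the item**: `padicPrincipalCoreST86_theoremA_proof :
Summit.ABC.ABC.Theses.PadicPrincipalCoreST86.TheoremA` (the route text is `TheoremAShape` with
`SymmBound` inlined).

Everything is [folklore] assembly; the mathematics is Waldschmidt 1980 / Yu 1990 transposed to the
principal-unit `p`-adic setting by the cell's chain (p1 WP-A1/A4/M, p2 WP-A2/A5, p3 WP-A3/J1–J3).
-/

noncomputable section

/-! ## Part 1 — the parameter pack, all inputs discharged -/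

open Finset
open Literature.NumberTheory.Transcendental
open Literature.NumberTheory.Transcendental.CW77 (heightProd hgt)
open Literature.NumberTheory.Transcendental.CW77.Setup (Idx Tau tauNorm)

namespace Literature.NumberTheory.Transcendental.PadicCW77.Setup

open Summit.ABC.StewartYu
open Summit.ABC.StewartYu.PadicW80Par (cLp')

variable (S : PadicCW77.Setup)

/-! ### The height link from the hypotheses of `CoreBound` -/

/-- **The height link of the flattening from `CoreBound`-style hypotheses** (`h(αⱼ) ≤ Vⱼ`,
`h(θ) ≤ V_θ`, `log max(3,|bⱼ|) ≤ W`, `log max(3,|b_θ|) ≤ W`). [folklore] -/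
theorem sizeHyp_of_logHeight {V : Fin S.d → ℝ} {Vθ W : ℝ} (hV : ∀ j, Height.logHeight₁ (S.α j) ≤ V j)
    (hVθ : Height.logHeight₁ S.θ ≤ Vθ) (hW : ∀ j, Real.log (max 3 (|S.b j| : ℝ)) ≤ W)
    (hWθ : Real.log (max 3 (|S.bθ| : ℝ)) ≤ W) : S.toQ.flat.SizeHyp V Vθ W := by
  have hexp : ∀ z : ℤ, Real.log (max 3 (|z| : ℝ)) ≤ W → |(z : ℝ)| ≤ Real.exp W := by
    intro z hz
    have h3 : (0 : ℝ) < max 3 (|z| : ℝ) := lt_max_of_lt_left (by norm_num)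
    have := Real.exp_le_exp.mpr hz
    rw [Real.exp_log h3] at this
    exact (le_max_right _ _).trans this
  have hHabs : ∀ q : ℚ, Real.log (hgt |q|) = Height.logHeight₁ q := fun q => by
    rw [SetupQ.hgt_abs, CW77.log_hgt_eq_logHeight₁]
  have hl : ∀ q : ℚ, q ≠ 0 → |Real.log ((|q| : ℚ) : ℝ)| ≤ Height.logHeight₁ q := fun q hq => by
    rw [Rat.cast_abs, ← CW77.log_hgt_eq_logHeight₁]; exact SetupQ.abs_log_abs_le_log_hgt hq
  exact
    { hH := fun j => by
        show Real.log (hgt |S.α j|) ≤ V j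
        rw [hHabs]; exact hV j
      hl := fun j => by
        show |Real.log ((|S.α j| : ℚ) : ℝ)| ≤ V j
        exact (hl _ (S.α_ne j)).trans (hV j)
      hHθ := by
        show Real.log (hgt |S.θ|) ≤ Vθ
        rw [hHabs]; exact hVθ
      hlθ := by
        show |Real.log ((|S.θ| : ℚ) : ℝ)| ≤ Vθ
        exact (hl _ S.θ_ne).trans hVθ
      hb := fun j => hexp _ (hW j)
      hbθ := hexp _ hWθ }

/-! ### The integer coefficient bound -/

/-- The integer coefficient bound of Siegel's step: `⌈#box₀ · 𝔅⁴ E(2)⌉`. [folklore] -/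
def PintP (P : PadicW80Par S.d) : ℤ :=
  ⌈((S.frame.box (h := P.hparp) (Lb := P.Lbp) P.Lp P.Lθp 0).card : ℝ) * (P.𝔅p ^ 4 * P.Efacp 2)⌉

/-- `PintP ≤ PrV = 2·𝔅⁵E(2)` (`#box₀ ≤ 𝔅`). [folklore] -/
theorem PintP_le_PrVp (P : PadicW80Par S.d) : (S.PintP P : ℝ) ≤ P.PrVp := by
  classical
  unfold PintP PadicW80Par.PrVp
  have hcard : ((S.frame.box (h := P.hparp) (Lb := P.Lbp) P.Lp P.Lθp 0).card : ℝ) ≤ P.𝔅p :=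
    S.toQ.flat.card_box_le_𝔅_p P 0
  have hE := P.Efacp_pos 2
  have hA0 : 0 ≤ P.𝔅p ^ 4 * P.Efacp 2 := by have := P.𝔅_pos; positivity
  have hA1 : 1 ≤ P.𝔅p ^ 5 * P.Efacp 2 :=
    one_le_mul_of_one_le_of_one_le (one_le_pow₀ P.one_le_𝔅) (P.one_le_Efacp (by norm_num))
  have h1 : ((S.frame.box (h := P.hparp) (Lb := P.Lbp) P.Lp P.Lθp 0).card : ℝ) * (P.𝔅p ^ 4 * P.Efacp 2) ≤
      P.𝔅p ^ 5 * P.Efacp 2 := by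
    calc ((S.frame.box (h := P.hparp) (Lb := P.Lbp) P.Lp P.Lθp 0).card : ℝ) * (P.𝔅p ^ 4 * P.Efacp 2)
        ≤ P.𝔅p * (P.𝔅p ^ 4 * P.Efacp 2) := mul_le_mul_of_nonneg_right hcard hA0
      _ = P.𝔅p ^ 5 * P.Efacp 2 := by ring
  have h2 := Int.ceil_lt_add_one (((S.frame.box (h := P.hparp) (Lb := P.Lbp) P.Lp P.Lθp 0).card : ℝ) *
    (P.𝔅p ^ 4 * P.Efacp 2))
  linarith

/-! ### The pack, all fields discharged -/

/-- **The `p`-adic parameter pack at p1's record**, every input of p2's `main` discharged from the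
height link, Kummer-freeness and the floor `log p ≤ V_θ`. [folklore] -/
def paramPackOf {P : PadicW80Par S.d} (hy : S.toQ.flat.SizeHyp P.Vs P.Vel P.Wb)
    (hind : ∀ T' : Finset (Fin (S.d + 1)), T'.Nonempty → ¬ IsSquare (∏ i ∈ T', S.all i))
    (hpV : Real.log S.p ≤ P.Vel) : S.ParamPack P.Up where
  h := P.hparp
  Lb := P.Lbp
  J₀ := P.J₀p
  L := P.Lp
  Lθ := P.Lθp
  S₀ := P.S₀p
  T := P.Tp
  P := S.PintP P
  t := P.tJp
  Dmax := fun _ k => P.DmaxK k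
  Mmax := fun _ k => P.MmaxK k
  hS₀ := P.even_S₀
  ht := fun _ hJ => P.one_le_tJ hJ
  htT := fun J _ => by have := P.tJ_mul_le J; nlinarith
  hUp := P.log_p_le_U hpV
  hsz := fun J hJ p inv => kSizes_of_hyp hy hJ (P.tJp J) (S.PintP_le_PrVp P) inv
  hfin := fun hΛ J hJ =>
    S.kFinal_of_log_ineq J P.S₀p (P.tJp J) (fun k => P.DmaxK k) (fun k => P.MmaxK k) hΛ
      (fun k _ => ⟨P.DmaxK_pos k, P.MmaxK_pos k⟩)
      (fun k hk => P.kstep_ineq_one S.hp3 hJ hk (P.logDM_le_budget k))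
      (fun k hk => P.kstep_ineq_two S.hp3 hJ hk (P.logDM_le_budget k))
  hhalf := fun hΛ J hJ => by
    have hp0 : (0 : ℝ) < S.p := by exact_mod_cast S.hp.pos
    have hΛ' : ‖S.Λ₀‖ ≤ (S.p : ℝ)⁻¹ := by
      refine hΛ.trans ?_
      rw [← Real.exp_log hp0, ← Real.exp_neg, Real.exp_le_exp]
      exact neg_le_neg (P.log_p_le_U hpV)
    have hroom : P.Tp / 2 ^ (J + 1) + P.tJp J ≤ P.Tp / 2 ^ J - S.d * P.tJp J := by
      have h2 := P.room_half J
      have e1 : (S.d + 1) * P.tJp J = S.d * P.tJp J + P.tJp J := by ring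
      rw [e1] at h2
      omega
    -- the height product against the sizes
    have hH1 : 1 ≤ heightProd S.all := CW77.one_le_heightProd _
    have hH : heightProd S.all ≤ Real.exp ((∑ j, P.Vs j) + P.Vel) := by
      have h1 := hy.heightProd_le
      rw [S.toQ.heightProd_flat_all, CW77.Setup.SizeHyp.sum_snoc] at h1
      exact h1
    refine S.halfStep_of hJ hind hΛ' (P.one_le_tJ hJ) P.even_S₀ hroom
      (hSizesHalf_of_hyp hy hJ (S.PintP_le_PrVp P)) ?_
    exact S.hFinalHalf_of_log_ineq J P.S₀p (P.tJp J) hΛ (by linarith [P.one_le_DmaxHp])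
      (by linarith [P.one_le_MmaxHp])
      (P.halfstep_ineq_one S.hp3 hJ (P.bhalf_le_budget hH1 hH))
      (P.halfstep_ineq_two S.hp3 hJ (P.bhalf_le_budget hH1 hH))
  hsiegel := siegel_of_hyp hy
  hend := endgame_of_params P _

/-- **`‖Λ₀‖_p > e^{−U}` at p1's parameter record** — p2's `norm_Λ₀_gt_of_paramPack` on `paramPackOf`:
the `p`-adic Waldschmidt descent, all inputs discharged. [folklore] -/
theorem norm_Λ₀_gt {P : PadicW80Par S.d} (hy : S.toQ.flat.SizeHyp P.Vs P.Vel P.Wb)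
    (hind : ∀ T' : Finset (Fin (S.d + 1)), T'.Nonempty → ¬ IsSquare (∏ i ∈ T', S.all i))
    (hpV : Real.log S.p ≤ P.Vel) : Real.exp (-P.Up) < ‖S.Λ₀‖ :=
  S.norm_Λ₀_gt_of_paramPack (S.paramPackOf hy hind hpV)

/-- **`‖Λ₀‖_p > e^{−U}` from the `CoreBound`-style height hypotheses** for any record
`P : PadicW80Par S.d` whose sizes dominate the data: `h(αⱼ) ≤ Vⱼ`, `h(θ) ≤ V_θ`,
`log max(3,|b|) ≤ W`, `log p ≤ V_θ`. [folklore] -/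
theorem norm_Λ₀_gt_of_logHeight (P : PadicW80Par S.d)
    (hind : ∀ T' : Finset (Fin (S.d + 1)), T'.Nonempty → ¬ IsSquare (∏ i ∈ T', S.all i))
    (hV : ∀ j, Height.logHeight₁ (S.α j) ≤ P.Vs j) (hVθ : Height.logHeight₁ S.θ ≤ P.Vel)
    (hW : ∀ j, Real.log (max 3 (|S.b j| : ℝ)) ≤ P.Wb) (hWθ : Real.log (max 3 (|S.bθ| : ℝ)) ≤ P.Wb)
    (hpV : Real.log S.p ≤ P.Vel) : Real.exp (-P.Up) < ‖S.Λ₀‖ :=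
  S.norm_Λ₀_gt (S.sizeHyp_of_logHeight hV hVθ hW hWθ) hind hpV

end Literature.NumberTheory.Transcendental.PadicCW77.Setup

/-! ## Part 2 — Theorem A -/

open Finset
open Literature.NumberTheory.Transcendental
open Literature.NumberTheory.Transcendental.PadicCW77

namespace Summit.ABC.StewartYu

/-- **Packs exist** for every signed Kummer-free set-up with `d ≥ 1`: the record `P` is the data
`(V, V_max, V_θ, W)` itself, the pack is `paramPackOf`, the exponent is `P.Up ≤ Cw(d+1)·…`
(`U_le_Cw'`). [folklore] -/
theorem packs_exist (S : PadicCW77.Setup) (V : Fin S.d → ℝ) (Vθ Vmax W : ℝ) (hd : 1 ≤ S.d)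
    (hK : ∀ T : Finset (Fin (S.d + 1)), T.Nonempty → ¬ IsSquare (∏ i ∈ T, S.all i))
    (_hμ : ∀ μ : Fin (S.d + 1) → ℤ, ∏ i, S.all i ^ μ i = 1 → μ = 0)
    (hV : ∀ j, Height.logHeight₁ (S.α j) ≤ V j) (hVθ : Height.logHeight₁ S.θ ≤ Vθ)
    (hVp : ∀ j, Real.log S.p ≤ V j) (hVθp : Real.log S.p ≤ Vθ) (hVm : ∀ j, V j ≤ Vmax) (hVθm : Vθ ≤ Vmax)
    (hW : ∀ j, Real.log (max 3 (|S.b j| : ℝ)) ≤ W) (hWθ : Real.log (max 3 (|S.bθ| : ℝ)) ≤ W) :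
    ∃ U : ℝ, U ≤ PadicW80Par.Cw (S.d + 1) * ((∏ j, V j) * Vθ) * (W + Real.log (2 * Vmax)) *
      Real.log (2 * Vmax) ∧ Nonempty (S.ParamPack U) := by
  -- `1 < log 3` and `1 ≤ log p` (inlined: the named forms exist elsewhere in the tree)
  have hlog3 : (1 : ℝ) < Real.log 3 := by
    rw [Real.lt_log_iff_exp_lt (by norm_num)]
    have := Real.exp_one_lt_d9; norm_num at this; linarith
  have hlp : (1 : ℝ) ≤ Real.log S.p :=
    hlog3.le.trans (Real.log_le_log (by norm_num) (by exact_mod_cast S.hp3))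
  have hW1 : (1 : ℝ) ≤ W := by
    have h3 : Real.log 3 ≤ Real.log (max 3 (|S.bθ| : ℝ)) :=
      Real.log_le_log (by norm_num) (le_max_left _ _)
    linarith [hWθ]
  let P : PadicW80Par S.d :=
    { Vs := V, Vmax := Vmax, Vel := Vθ, Wb := W
      hV := fun j => hlp.trans (hVp j)
      hVmax := hVm
      hVmax1 := (hlp.trans hVθp).trans hVθm
      hVθ1 := hlp.trans hVθp
      hVθmax := hVθm
      hW := hW1
      hd := hd }
  exact ⟨P.Up, P.U_le_Cw', ⟨S.paramPackOf (P := P) (S.sizeHyp_of_logHeight hV hVθ hW hWθ) hK hVθp⟩⟩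

/-- **Theorem A with `c₁ = 2⁷⁰`, `c₂ = 1`** (`TheoremAShapeLe 1`; route B₃'s `TheoremAOne` shape).
[folklore] -/
theorem theoremAShapeLe_one_holds : TheoremAShapeLe 1 :=
  theoremAShapeLe_of_packs (Cw := PadicW80Par.Cw) (c₁ := 2 ^ 70) (c₂ := 1) (by norm_num) (by norm_num)
    le_rfl (fun _ hm => PadicW80Par.two_le_Cw hm) (fun _ hm => PadicW80Par.two_mul_Cw_le hm)
    (fun S V Vθ Vmax W hd hK hμ hV hVθ hVp hVθp hVm hVθm hW hWθ =>
      packs_exist S V Vθ Vmax W hd hK hμ hV hVθ hVp hVθp hVm hVθm hW hWθ)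

/-- **THEOREM A** (the cell's `TheoremAShape`, cap `c₂ ≤ 10`; verbatim the statement of the route
item `Summit.ABC.ABC.Theses.PadicPrincipalCoreST86.TheoremA`). [folklore] -/
theorem theoremAShape_holds : TheoremAShape :=
  theoremAShape_of_packs (Cw := PadicW80Par.Cw) (c₁ := 2 ^ 70) (c₂ := 1) (by norm_num) (by norm_num)
    (by norm_num) (fun _ hm => PadicW80Par.two_le_Cw hm) (fun _ hm => PadicW80Par.two_mul_Cw_le hm)
    (fun S V Vθ Vmax W hd hK hμ hV hVθ hVp hVθp hVm hVθm hW hWθ =>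
      packs_exist S V Vθ Vmax W hd hK hμ hV hVθ hVp hVθp hVm hVθm hW hWθ)

end Summit.ABC.StewartYu

end

/-! ## Part 3 — the route item -/

set_option linter.dupNamespace false

namespace Summit.ABC.ABC.Theorems

/-- **Item `TheoremA` of route PadicPrincipalCoreST86** (Theorem A: Yu-type lower bound for `p`-adic
linear forms in logarithms of principal units with constant `c₁^m m^{c₂m}`, here `c₁ = 2⁷⁰`,
`c₂ = 1 ≤ 10`, `r = 0`). [folklore] -/
theorem padicPrincipalCoreST86_theoremA_proof : Summit.ABC.ABC.Theses.PadicPrincipalCoreST86.TheoremA :=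
  Summit.ABC.StewartYu.theoremAShape_holds

end Summit.ABC.ABC.Theorems
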